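import Summits.ResolutionOfSingularities.ResolutionOfSingularities.Theses.FoliationDescent
import Literature.AlgebraicGeometry.Resolution.DerivativeIdealsLocalization
import Literature.AlgebraicGeometry.Resolution.AbhyankarValuationsLocalUniformization
import Mathlib.Algebra.Field.ZMod
import Mathlib.Algebra.CharP.Two
import HarnessLib

/-!
# `LogCanQuotLU` — negative lemmas, part V: the plane witness `k[X₀, X₁] ⊆ k(X₀, X₁)`
# dominated by a valuation ring (bookkeeping for parts VI–VIII)

Support (negative) lemmas for crux `stmt-ResolutionOfSingularities-17082`
(`Summit.ResolutionOfSingularities.ResolutionOfSingularities.Theses.FoliationDescent.LogCanQuotLU`,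
route `FoliationDescent`, crux #3 "log-canonical quotients uniformize"), filed by the standing
disprover (cdisprove gen 2; work file `Cruxes/LogCanQuotLU/Disproof.lean` §6). This file declares
NO definition and NO declaration concludes the route decl positively.

The witness data (generic ground field `k`): `A = k[X₀, X₁]`, `K = Frac A`, `S' = A` seen in `K`
(the range of `A → K`), and a valuation ring `O` of `K` DOMINATING `A_(X₀,X₁)` (Chevalley,
`IsLocalRing.exists_factor_valuationRing`): `S' ≤ O`, a polynomial with non-zero constant term is a
unit of `O`, one with zero constant term is not (`exists_valuationSubring_dominating_origin`). Then
`S'` is finitely generated, `Frac S' = K`, and `S'` is regular at the centre of `O` (indeed at every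
prime: Mathlib's `IsRegularRing (MvPolynomial _ k)`), and the local ring `S'_c` at the centre is
`{α/β : β(0) ≠ 0}` (`plane_memSc_iff`). Derivations of `K` are compared on `X₀, X₁`
(`derivation_eq_of_apply_X_eq`), and a derivation of `K` restricting to `A` maps `S'_c` into itself
(`plane_derivation_mapsTo`).

Also: in characteristic `2`, the Euler field `E = X₀∂₀ + X₁∂₁` (`E ∘ E = E`, multiplicative with
`u = 1`, singular at the origin) and `∂₀` (`∂₀ ∘ ∂₀ = 0`, non-singular) of `K`
(`exists_eulerDerivation_plane`, `exists_pderivZero_plane`). Used by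
`Negative/HypothesesInhabited.lean` (non-vacuity of the crux in both regimes; `R`-constancy is
load-bearing) and `Negative/ConstantsNotRegularMultiplicative.lean` (the `A₁` tightness witness).

## Sources
* C. Chevalley / O. Zariski–P. Samuel, *Commutative Algebra* II (1960), Ch. VI §4 (every local
  subring of a field is dominated by a valuation ring). [ZariskiSamuel1960]
* N. Jacobson, *Lectures in Abstract Algebra* III (1964), Ch. IV §8 (`p`-closed derivations).
  [folklore computations here]
-/

noncomputable section

set_option linter.dupNamespace false -- mandated namespace of this single-conjunct summit

open IsLocalRing MvPolynomial
open Literature.AlgebraicGeometry.Resolution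

namespace Summit.ResolutionOfSingularities.ResolutionOfSingularities.Theorems.LogCanQuotLU.Negative

section Plane

variable (k : Type) [Field k]

/-- **Chevalley domination of the origin.** There is a valuation ring `O` of `k(X₀, X₁)` containing
`k[X₀, X₁]` in which a polynomial with non-zero constant term is a unit and a non-zero polynomial
with zero constant term is not. [cite: ZariskiSamuel1960, Ch. VI §4, Thm. 5] -/
theorem exists_valuationSubring_dominating_origin :
    ∃ O : ValuationSubring (FractionRing (MvPolynomial (Fin 2) k)),
      (∀ a : MvPolynomial (Fin 2) k,
          algebraMap (MvPolynomial (Fin 2) k) (FractionRing (MvPolynomial (Fin 2) k)) a ∈ O) ∧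
      (∀ a : MvPolynomial (Fin 2) k, constantCoeff a ≠ 0 →
          (algebraMap (MvPolynomial (Fin 2) k) (FractionRing (MvPolynomial (Fin 2) k)) a)⁻¹ ∈ O) ∧
      (∀ a : MvPolynomial (Fin 2) k, constantCoeff a = 0 →
          (algebraMap (MvPolynomial (Fin 2) k) (FractionRing (MvPolynomial (Fin 2) k)) a)⁻¹ ∈ O →
            a = 0) := by
  classical
  let A : Type := MvPolynomial (Fin 2) k
  let K : Type := FractionRing A
  let 𝔪 : Ideal A := RingHom.ker (constantCoeff : A →+* k)
  haveI h𝔪 : 𝔪.IsMaximal :=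
    RingHom.ker_isMaximal_of_surjective _ fun c => ⟨C c, constantCoeff_C _ c⟩
  have hmem𝔪 : ∀ a : A, a ∈ 𝔪 ↔ constantCoeff a = 0 := fun a => RingHom.mem_ker
  have hinj : Function.Injective (algebraMap A K) := IsFractionRing.injective A K
  have hunits : ∀ y : 𝔪.primeCompl, IsUnit (algebraMap A K y) := by
    intro y
    have hy0 : (y : A) ≠ 0 := fun h => y.2 (by rw [h]; exact 𝔪.zero_mem)
    exact isUnit_iff_ne_zero.mpr ((map_ne_zero_iff _ hinj).mpr hy0)
  let f : Localization.AtPrime 𝔪 →+* K := IsLocalization.lift (M := 𝔪.primeCompl) hunits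
  have hf : ∀ a : A, f (algebraMap A (Localization.AtPrime 𝔪) a) = algebraMap A K a := fun a =>
    IsLocalization.lift_eq hunits a
  obtain ⟨O, hO, hloc⟩ := IsLocalRing.exists_factor_valuationRing f
  refine ⟨O, fun a => ?_, fun a ha => ?_, fun a ha hinv => ?_⟩
  · rw [← hf]
    exact hO _
  · have ha' : a ∈ 𝔪.primeCompl := fun h => ha ((hmem𝔪 a).mp h)
    have hu : IsUnit (algebraMap A (Localization.AtPrime 𝔪) a) :=
      IsLocalization.map_units (Localization.AtPrime 𝔪) ⟨a, ha'⟩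
    obtain ⟨u, hu'⟩ := hu.map (f.codRestrict O.toSubring hO)
    have hval : ((u : O.toSubring) : K) = algebraMap A K a := by
      rw [hu', RingHom.codRestrict_apply, hf]
    have h1 : algebraMap A K a * (((u⁻¹ : (O.toSubring)ˣ) : O.toSubring) : K) = 1 := by
      rw [← hval, ← Subring.coe_mul, Units.mul_inv, Subring.coe_one]
    rw [← eq_inv_of_mul_eq_one_right h1]
    exact Subtype.mem _
  · by_contra ha0
    have hK0 : algebraMap A K a ≠ 0 := (map_ne_zero_iff _ hinj).mpr ha0
    have hmemO : algebraMap A K a ∈ O := by rw [← hf]; exact hO _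
    -- `algebraMap a` is a unit of `O`, hence (local hom) `a` is a unit of `A_𝔪`: contradiction
    have hu : IsUnit (f.codRestrict O.toSubring hO (algebraMap A (Localization.AtPrime 𝔪) a)) := by
      refine IsUnit.of_mul_eq_one (⟨(algebraMap A K a)⁻¹, hinv⟩ : O.toSubring) ?_
      apply Subtype.ext
      rw [Subring.coe_mul, RingHom.codRestrict_apply, Subring.coe_one]
      change f _ * (algebraMap A K a)⁻¹ = 1
      rw [hf, mul_inv_cancel₀ hK0]
    have hu' : IsUnit (algebraMap A (Localization.AtPrime 𝔪) a) := IsLocalHom.map_nonunit _ hu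
    rw [IsLocalization.AtPrime.isUnit_to_map_iff (Localization.AtPrime 𝔪) 𝔪 a] at hu'
    exact hu' ((hmem𝔪 a).mpr ha)

variable {k}

variable (S' : Subalgebra k (FractionRing (MvPolynomial (Fin 2) k)))
  (hS' : S' = (IsScalarTower.toAlgHom k (MvPolynomial (Fin 2) k)
    (FractionRing (MvPolynomial (Fin 2) k))).range)

section Model

include hS'

/-- Membership in the polynomial model `S' = k[X₀, X₁] ⊆ k(X₀, X₁)`. [folklore] -/
theorem plane_mem_iff (x : FractionRing (MvPolynomial (Fin 2) k)) :
    x ∈ S' ↔ ∃ a : MvPolynomial (Fin 2) k,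
      algebraMap (MvPolynomial (Fin 2) k) (FractionRing (MvPolynomial (Fin 2) k)) a = x := by
  subst hS'
  rw [AlgHom.mem_range]
  rfl

/-- `S' = k[X₀, X₁]` is finitely generated. [folklore] -/
theorem plane_fg : S'.FG := by
  subst hS'
  rw [← Algebra.map_top]
  exact Algebra.FiniteType.out.map _

/-- `Frac k[X₀, X₁] = k(X₀, X₁)` for the model `S'`. [folklore] -/
theorem plane_isFractionRing : IsFractionRing S' (FractionRing (MvPolynomial (Fin 2) k)) := by
  refine IsFractionRing.of_field S' _ fun z => ?_
  obtain ⟨a, b, -, rfl⟩ := IsFractionRing.div_surjective (A := MvPolynomial (Fin 2) k) z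
  exact ⟨⟨_, (plane_mem_iff S' hS' _).mpr ⟨a, rfl⟩⟩, ⟨_, (plane_mem_iff S' hS' _).mpr ⟨b, rfl⟩⟩,
    rfl⟩

/-- **The polynomial model is regular at the centre of EVERY valuation ring containing it**
(Mathlib: `k[X₀, X₁]` is a regular ring). [folklore] -/
theorem plane_isRegularLocalRing_centre (O : ValuationSubring (FractionRing (MvPolynomial (Fin 2) k)))
    (h' : S'.toSubring ≤ O.toSubring) :
    IsRegularLocalRing
      (Localization.AtPrime (Ideal.comap (Subring.inclusion h') (maximalIdeal O))) := by
  classical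
  have hinj : Function.Injective (algebraMap (MvPolynomial (Fin 2) k)
      (FractionRing (MvPolynomial (Fin 2) k))) := IsFractionRing.injective _ _
  have hmem : ∀ a : MvPolynomial (Fin 2) k,
      algebraMap (MvPolynomial (Fin 2) k) (FractionRing (MvPolynomial (Fin 2) k)) a ∈
        S'.toSubring := fun a => (plane_mem_iff S' hS' _).mpr ⟨a, rfl⟩
  let φ : MvPolynomial (Fin 2) k →+* S'.toSubring := (algebraMap _ _).codRestrict S'.toSubring hmem
  have hφ : Function.Bijective φ := by
    refine ⟨fun a b h => hinj (congrArg Subtype.val h), fun x => ?_⟩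
    obtain ⟨a, ha⟩ := (plane_mem_iff S' hS' _).mp x.2
    exact ⟨a, Subtype.ext ha⟩
  let e : MvPolynomial (Fin 2) k ≃+* S'.toSubring := RingEquiv.ofBijective φ hφ
  rw [isRegularLocalRing_localization_iff_of_ringEquiv e]
  infer_instance

/-- `S' ≤ O` as soon as `O` contains the polynomials. [folklore] -/
theorem plane_toSubring_le (O : ValuationSubring (FractionRing (MvPolynomial (Fin 2) k)))
    (hO₀ : ∀ a : MvPolynomial (Fin 2) k,
      algebraMap (MvPolynomial (Fin 2) k) (FractionRing (MvPolynomial (Fin 2) k)) a ∈ O) :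
    S'.toSubring ≤ O.toSubring := by
  intro x hx
  obtain ⟨a, rfl⟩ := (plane_mem_iff S' hS' x).mp hx
  exact hO₀ a

/-- **The local ring of `S'` at the centre of a dominating `O`** is `{α / β : β(0) ≠ 0}`.
[folklore] -/
theorem plane_memSc_iff (O : ValuationSubring (FractionRing (MvPolynomial (Fin 2) k)))
    (hO₁ : ∀ a : MvPolynomial (Fin 2) k, constantCoeff a ≠ 0 →
      (algebraMap (MvPolynomial (Fin 2) k) (FractionRing (MvPolynomial (Fin 2) k)) a)⁻¹ ∈ O)
    (hO₂ : ∀ a : MvPolynomial (Fin 2) k, constantCoeff a = 0 →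
      (algebraMap (MvPolynomial (Fin 2) k) (FractionRing (MvPolynomial (Fin 2) k)) a)⁻¹ ∈ O →
        a = 0)
    (x : FractionRing (MvPolynomial (Fin 2) k)) :
    (∃ a b : FractionRing (MvPolynomial (Fin 2) k), a ∈ S' ∧ b ∈ S' ∧ b ≠ 0 ∧ b⁻¹ ∈ O ∧
        x = a / b) ↔
      ∃ α β : MvPolynomial (Fin 2) k, constantCoeff β ≠ 0 ∧
        x = algebraMap _ (FractionRing (MvPolynomial (Fin 2) k)) α /
          algebraMap _ (FractionRing (MvPolynomial (Fin 2) k)) β := by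
  have hinj : Function.Injective (algebraMap (MvPolynomial (Fin 2) k)
      (FractionRing (MvPolynomial (Fin 2) k))) := IsFractionRing.injective _ _
  constructor
  · rintro ⟨a, b, ha, hb, hb0, hbinv, rfl⟩
    obtain ⟨α, rfl⟩ := (plane_mem_iff S' hS' _).mp ha
    obtain ⟨β, rfl⟩ := (plane_mem_iff S' hS' _).mp hb
    refine ⟨α, β, fun h0 => hb0 ?_, rfl⟩
    rw [hO₂ β h0 hbinv, map_zero]
  · rintro ⟨α, β, hβ, rfl⟩
    have hβ0 : β ≠ 0 := fun h => hβ (by rw [h, map_zero])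
    exact ⟨_, _, (plane_mem_iff S' hS' _).mpr ⟨α, rfl⟩, (plane_mem_iff S' hS' _).mpr ⟨β, rfl⟩,
      (map_ne_zero_iff _ hinj).mpr hβ0, hO₁ β hβ, rfl⟩

/-- **A derivation of `k(X₀, X₁)` that restricts to `k[X₀, X₁]` maps the local ring `S'_c` into
itself** (quotient rule, `(β²)(0) = β(0)² ≠ 0`). [folklore] -/
theorem plane_derivation_mapsTo (O : ValuationSubring (FractionRing (MvPolynomial (Fin 2) k)))
    (hO₁ : ∀ a : MvPolynomial (Fin 2) k, constantCoeff a ≠ 0 →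
      (algebraMap (MvPolynomial (Fin 2) k) (FractionRing (MvPolynomial (Fin 2) k)) a)⁻¹ ∈ O)
    (hO₂ : ∀ a : MvPolynomial (Fin 2) k, constantCoeff a = 0 →
      (algebraMap (MvPolynomial (Fin 2) k) (FractionRing (MvPolynomial (Fin 2) k)) a)⁻¹ ∈ O →
        a = 0)
    (Δ : Derivation k (FractionRing (MvPolynomial (Fin 2) k)) (FractionRing (MvPolynomial (Fin 2) k)))
    (δ : Derivation k (MvPolynomial (Fin 2) k) (MvPolynomial (Fin 2) k))
    (hΔ : ∀ a, Δ (algebraMap _ _ a) = algebraMap _ _ (δ a))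
    (x : FractionRing (MvPolynomial (Fin 2) k))
    (hx : ∃ a b : FractionRing (MvPolynomial (Fin 2) k), a ∈ S' ∧ b ∈ S' ∧ b ≠ 0 ∧ b⁻¹ ∈ O ∧
      x = a / b) :
    ∃ a b : FractionRing (MvPolynomial (Fin 2) k), a ∈ S' ∧ b ∈ S' ∧ b ≠ 0 ∧ b⁻¹ ∈ O ∧
      Δ x = a / b := by
  have hinj : Function.Injective (algebraMap (MvPolynomial (Fin 2) k)
      (FractionRing (MvPolynomial (Fin 2) k))) := IsFractionRing.injective _ _
  obtain ⟨α, β, hβ, rfl⟩ := (plane_memSc_iff S' hS' O hO₁ hO₂ x).mp hx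
  refine (plane_memSc_iff S' hS' O hO₁ hO₂ _).mpr ⟨β * δ α - α * δ β, β * β, ?_, ?_⟩
  · rw [map_mul]
    exact mul_ne_zero hβ hβ
  · have hβ0 : algebraMap _ (FractionRing (MvPolynomial (Fin 2) k)) β ≠ 0 :=
      (map_ne_zero_iff _ hinj).mpr fun h => hβ (by rw [h, map_zero])
    rw [Derivation.leibniz_div, hΔ, hΔ, map_sub, map_mul, map_mul, map_mul, smul_eq_mul,
      smul_eq_mul]
    ring

end Model

/-- **Derivations of `k(X₀, X₁)` are determined by their values on `X₀, X₁`.** [folklore] -/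
theorem derivation_eq_of_apply_X_eq
    (Δ₁ Δ₂ : Derivation k (FractionRing (MvPolynomial (Fin 2) k))
      (FractionRing (MvPolynomial (Fin 2) k)))
    (h : ∀ i : Fin 2, Δ₁ (algebraMap (MvPolynomial (Fin 2) k) _ (X i)) = Δ₂ (algebraMap (MvPolynomial (Fin 2) k) _ (X i))) : Δ₁ = Δ₂ := by
  have hA : Δ₁.compAlgebraMap (MvPolynomial (Fin 2) k) =
      Δ₂.compAlgebraMap (MvPolynomial (Fin 2) k) :=
    MvPolynomial.derivation_ext fun i => by
      rw [Derivation.compAlgebraMap_apply, Derivation.compAlgebraMap_apply]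
      exact h i
  have ha : ∀ a : MvPolynomial (Fin 2) k, Δ₁ (algebraMap _ _ a) = Δ₂ (algebraMap _ _ a) := by
    intro a
    have := DFunLike.congr_fun hA a
    rwa [Derivation.compAlgebraMap_apply, Derivation.compAlgebraMap_apply] at this
  refine Derivation.ext fun x => ?_
  obtain ⟨a, b, -, rfl⟩ := IsFractionRing.div_surjective (A := MvPolynomial (Fin 2) k) x
  rw [Derivation.leibniz_div, Derivation.leibniz_div, ha, ha]

/-- In characteristic `2` the square `Δ ∘ Δ` of a derivation is a derivation. [folklore] -/
theorem exists_derivation_comp_self_two {F : Type} [Field F] [Algebra k F] [CharP F 2]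
    (Δ : Derivation k F F) : ∃ Δ₂ : Derivation k F F, ∀ x, Δ₂ x = Δ (Δ x) :=
  ⟨{ toLinearMap := (Δ : F →ₗ[k] F).comp (Δ : F →ₗ[k] F)
     map_one_eq_zero' := by simp
     leibniz' := fun a b => by
       simp only [LinearMap.coe_comp, Function.comp_apply, Derivation.coeFn_coe,
         Derivation.leibniz, map_add, smul_eq_mul]
       have h2 : Δ b * Δ a + Δ a * Δ b = 0 := by
         rw [mul_comm (Δ b) (Δ a)]
         exact CharTwo.add_self_eq_zero _
       linear_combination h2 }, fun _ => rfl⟩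

/-- **The Euler field** `E = X₀∂₀ + X₁∂₁` of `k(X₀, X₁)` in characteristic `2`: it restricts to
`k[X₀, X₁]`, fixes `X₀` and `X₁`, and `E ∘ E = E` (multiplicative, `u = 1`). [folklore] -/
theorem exists_eulerDerivation_plane [CharP k 2] :
    ∃ E : Derivation k (FractionRing (MvPolynomial (Fin 2) k))
        (FractionRing (MvPolynomial (Fin 2) k)),
      (∀ a : MvPolynomial (Fin 2) k, E (algebraMap _ _ a) =
        algebraMap (MvPolynomial (Fin 2) k) _ (X 0 * pderiv 0 a + X 1 * pderiv 1 a)) ∧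
      E (algebraMap (MvPolynomial (Fin 2) k) _ (X 0)) = algebraMap (MvPolynomial (Fin 2) k) _ (X 0) ∧
      E (algebraMap (MvPolynomial (Fin 2) k) _ (X 1)) = algebraMap (MvPolynomial (Fin 2) k) _ (X 1) ∧
      ∀ x, E (E x) = E x := by
  classical
  let A : Type := MvPolynomial (Fin 2) k
  let K : Type := FractionRing A
  haveI : CharP K 2 := charP_of_injective_algebraMap (algebraMap k K).injective 2
  obtain ⟨D₀, hD₀⟩ :=
    exists_derivation_extend_of_isLocalization k K (nonZeroDivisors A) (pderiv 0 : Derivation k A A)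
  obtain ⟨D₁, hD₁⟩ :=
    exists_derivation_extend_of_isLocalization k K (nonZeroDivisors A) (pderiv 1 : Derivation k A A)
  let E : Derivation k K K := algebraMap A K (X 0) • D₀ + algebraMap A K (X 1) • D₁
  have hE : ∀ a : A, E (algebraMap A K a) = algebraMap A K (X 0 * pderiv 0 a + X 1 * pderiv 1 a) := by
    intro a
    simp only [E, Derivation.add_apply, Derivation.smul_apply, smul_eq_mul, hD₀, hD₁, map_add,
      map_mul]
  have hE0 : E (algebraMap A K (X 0)) = algebraMap A K (X 0) := by
    rw [hE, pderiv_X_self, pderiv_X_of_ne (by decide), mul_one, mul_zero, add_zero]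
  have hE1 : E (algebraMap A K (X 1)) = algebraMap A K (X 1) := by
    rw [hE, pderiv_X_of_ne (by decide), pderiv_X_self, mul_one, mul_zero, zero_add]
  obtain ⟨E₂, hE₂⟩ := exists_derivation_comp_self_two E
  have hEE : E₂ = E := derivation_eq_of_apply_X_eq E₂ E fun i => by
    fin_cases i
    · show E₂ (algebraMap A K (X 0)) = E (algebraMap A K (X 0))
      rw [hE₂, hE0, hE0]
    · show E₂ (algebraMap A K (X 1)) = E (algebraMap A K (X 1))
      rw [hE₂, hE1, hE1]
  exact ⟨E, hE, hE0, hE1, fun x => by rw [← hE₂, hEE]⟩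

/-- **The field `∂₀ = ∂/∂X₀`** of `k(X₀, X₁)` in characteristic `2`: it restricts to `k[X₀, X₁]`,
`∂₀ X₀ = 1`, `∂₀ X₁ = 0`, and `∂₀ ∘ ∂₀ = 0` (`2`-closed with `c = 0`). [folklore] -/
theorem exists_pderivZero_plane [CharP k 2] :
    ∃ D : Derivation k (FractionRing (MvPolynomial (Fin 2) k))
        (FractionRing (MvPolynomial (Fin 2) k)),
      (∀ a : MvPolynomial (Fin 2) k, D (algebraMap _ _ a) = algebraMap _ _ (pderiv 0 a)) ∧
      D (algebraMap (MvPolynomial (Fin 2) k) _ (X 0)) = 1 ∧ D (algebraMap (MvPolynomial (Fin 2) k) _ (X 1)) = 0 ∧ ∀ x, D (D x) = 0 := by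
  classical
  let A : Type := MvPolynomial (Fin 2) k
  let K : Type := FractionRing A
  haveI : CharP K 2 := charP_of_injective_algebraMap (algebraMap k K).injective 2
  obtain ⟨D, hD⟩ :=
    exists_derivation_extend_of_isLocalization k K (nonZeroDivisors A) (pderiv 0 : Derivation k A A)
  have hD0 : D (algebraMap A K (X 0)) = 1 := by rw [hD, pderiv_X_self, map_one]
  have hD1 : D (algebraMap A K (X 1)) = 0 := by
    rw [hD, pderiv_X_of_ne (by decide), map_zero]
  obtain ⟨D₂, hD₂⟩ := exists_derivation_comp_self_two D
  have hDD : D₂ = 0 := derivation_eq_of_apply_X_eq D₂ 0 fun i => by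
    fin_cases i
    · show D₂ (algebraMap A K (X 0)) = (0 : Derivation k K K) (algebraMap A K (X 0))
      rw [hD₂, hD0, Derivation.zero_apply, Derivation.map_one_eq_zero]
    · show D₂ (algebraMap A K (X 1)) = (0 : Derivation k K K) (algebraMap A K (X 1))
      rw [hD₂, hD1, Derivation.zero_apply, map_zero]
  exact ⟨D, hD, hD0, hD1, fun x => by rw [← hD₂, hDD, Derivation.zero_apply]⟩

end Plane

end Summit.ResolutionOfSingularities.ResolutionOfSingularities.Theorems.LogCanQuotLU.Negative

end
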